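import Mathlib
import HarnessLib
import Summits.HubbardSuperconductivity.HubbardSuperconductivity.Theorems.KLProgrammeKLRegimeEngineTwoLegSpLegStepSplit

/-!
# Row C2 (`hsp`) of stubs (e)/(M) of `KLRegimeEngineV17F2` (stmt-HubbardSuperconductivity-20437) at every scale — PRIVATE RATES:
# the induction vehicle for the one-step split door of `…EngineTwoLegSpLegStepSplit` (cell gate-hubbard-kl, seat hubbard-kl-k3c5-p2 g7)

Sequel of `…EngineTwoLegSpLegStepSplit` (§1–§5 there).  The strong induction on the scale (r2d-p1's `spLeg_allScales_of_step_hist`) runs on ANY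
rate sequence `a`; the registered `hsp` text only asks `≤ Q.CL β n / 4 / L₁` at the END.  This file states the all-scales leg on PRIVATE rates `a`
with `a n ≤ Q.CL β n / 4`, closed to the public quarter budget by monotonicity — the form a supplier must use at deep scales (numbers below).
Proofs only (one composition); no definitions; nothing about the model is asserted; nothing asserts superconductivity.
References: BGM 2006 §2.4 (2.23), Lemma 2.1 (2.40) [cite: BenfattoGiulianiMastropietro2006].
-/

noncomputable section

namespace Summit.HubbardSuperconductivity.HubbardSuperconductivity.Theorems.EngineV8

set_option linter.dupNamespace false -- summit = problem name (single-conjunct summit), D-0017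

open Real Finset Set Literature.MathematicalPhysics.QuantumLattice Literature.Probability.LatticeModels
open Literature.MathematicalPhysics.QuantumLattice.BandSectorCounting
open Summit.HubbardSuperconductivity.HubbardSuperconductivity.Theorems.KLProgrammeLegKernels
open Summit.HubbardSuperconductivity.HubbardSuperconductivity.Theorems.DispersionFlow
open Summit.HubbardSuperconductivity.HubbardSuperconductivity.Theorems.PerturbedFermiCurve
open Summit.HubbardSuperconductivity.HubbardSuperconductivity.Theorems.KLRegimeSplit
open Summit.HubbardSuperconductivity.HubbardSuperconductivity.Theorems.TwoPointAssembly

section V17F2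

variable {L : ℕ} {G : GeoConsts} {P : SplitConsts} {Q : EngConsts} {R : RenConsts} {β U μ c : ℝ}

/-! ## §1 PRIVATE RATES — the induction vehicle; the public quarter budget `Q.CL β n / 4` is only the ceiling

The induction of `…SpLegStepSplit` §4 runs on ANY rate sequence `a`; the registered `hsp` text only asks `≤ Q.CL β n / 4 / L₁` at the END.  Running it on the public
tolerances themselves (`a m := Q.CL β m/4 = 2^58·Psq²·Rsq²·(β²+1)·4^m` for the `klEngQ6/7/8` packages) makes the frame-distance tube
`F_n/L₁ = (Q.CL β 0/4)(4^n − 1)/(3L₁)` WIDER than the scale-`n` shell `Λ_n = 4^{-n}/32` at the deepest scales once `β ≳ 2^9/U`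
(`L₁ ≥ klEngL₃ β U ≈ 2^{10}β²/U²` or `klEngL₄ ≈ 2^{61}Psq²Rsq²β³/U` against the requirement `L₁ ≥ (32/3)·(Q.CL β 0/4)·16^n ≈ 2^{52}Psq²Rsq²β⁴`
at `n = nScales β + 1`, `16^{n_β+1} ≤ β²/(64π²)`), so neither the shell-tube gradient (R) nor a shell-local defect (D) would be available there.
On PRIVATE geometric rates `a m := d·3^m` (any ratio in `(2 + O(U), 4)` absorbs the coefficient-`1` recursion of the COUNT in `…SpLegStepSplit`) the tube is
`F_n/L₁ ≤ d·3^n/(2L₁) ≤ Λ_n` as soon as `16·d·12^n ≤ L₁`, i.e. `L₁ ≳ d·β^{1.8}/20` at the last scale — inside `klEngL₃` for every `β`. -/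

/-- **ROW C2 (`hsp`) AT EVERY SCALE `n ≤ N ≤ nScales β + 1` FROM PER-SCALE POINT ESTIMATES ON PRIVATE RATES `a`**, closed to the public quarter
budget by `a n ≤ Q.CL β n / 4` (KL regime, `0 ≤ Gfr`, bare frame admissible `h0`): (R) `hgrad`, (D) `hD` and the budget
`b n·(Σ_{m<n} a m)/klCurveD + d n ≤ a n` are stated with the PRIVATE rates below `n` in their binders (that is what the induction supplies);
the conclusion is the literal `hsp` hypothesis of the (e)/(M) closers (history `histV17F2 ∧ TwoLegSlopes` at `(G, P, Q, R)`). -/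
theorem spLeg_allScales_of_pointDefects_V17F2_rates (hR : ∀ j, 0 ≤ R.Gfr j) (hc : 0 < c) (hcle : c ≤ klCurveC3 R) (hU : 0 < U)
    (hUle : U ≤ klCurveU0 R) (hβmin : klBetaMin ≤ β) (hβc : β ≤ Real.exp (c / U ^ 2)) (hμ : μ ∈ klWindowC)
    (h0 : FrameOK R U (nScales β) μ 0) {N : ℕ} (hN : N ≤ nScales β + 1) {a b d : ℕ → ℝ} (ha : ∀ n ≤ N, a n ≤ Q.CL β n / 4)
    (hb : ∀ n ≤ N, 0 ≤ b n)
    (hgrad : ∀ n ≤ N, ∀ (Mq : ℕ → ℕ) (L₁ L₂ M₂ : ℕ) [NeZero L₁] [NeZero L₂] [NeZero M₂], L ≤ L₁ → L₁ ∣ L₂ → Q.M0 β L₁ ≤ M₂ →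
      Mq L₁ ≤ M₂ → Q.M0 β L₂ ≤ M₂ → Mq L₂ ≤ M₂ →
      (∀ j < n, histV17F2 L₁ M₂ G P Q R β U μ j ∧ TwoLegSlopes L₁ M₂ R β U μ (klFlowFrameU L₁ M₂ β U μ j) j) →
      (∀ j < n, histV17F2 L₂ M₂ G P Q R β U μ j ∧ TwoLegSlopes L₂ M₂ R β U μ (klFlowFrameU L₂ M₂ β U μ j) j) →
      (∀ m < n, ∀ θ : ℝ, |klLocalPart L₁ M₂ β U μ (klFlowFrameU L₁ M₂ β U μ m) m θ -
        klLocalPart L₂ M₂ β U μ (klFlowFrameU L₂ M₂ β U μ m) m θ| ≤ a m / L₁) →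
      (∀ q : Fin 2 → ℝ, |(klFlowFrameU L₁ M₂ β U μ n).eval q - (klFlowFrameU L₂ M₂ β U μ n).eval q| ≤ (∑ m ∈ range n, a m) / L₁) →
        ∀ q : Momentum, |frameLevel μ (klFlowFrameU L₁ M₂ β U μ n) q| ≤ (∑ m ∈ range n, a m) / L₁ →
          ‖fderiv ℝ (evalM (symInterp L₁ (klLocSelfEnergyRe L₁ M₂ β U μ (klFlowFrameU L₁ M₂ β U μ n) n))) q‖ ≤ b n)
    (hD : ∀ n ≤ N, ∀ (Mq : ℕ → ℕ) (L₁ L₂ M₂ : ℕ) [NeZero L₁] [NeZero L₂] [NeZero M₂], L ≤ L₁ → L₁ ∣ L₂ → Q.M0 β L₁ ≤ M₂ →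
      Mq L₁ ≤ M₂ → Q.M0 β L₂ ≤ M₂ → Mq L₂ ≤ M₂ →
      (∀ j < n, histV17F2 L₁ M₂ G P Q R β U μ j ∧ TwoLegSlopes L₁ M₂ R β U μ (klFlowFrameU L₁ M₂ β U μ j) j) →
      (∀ j < n, histV17F2 L₂ M₂ G P Q R β U μ j ∧ TwoLegSlopes L₂ M₂ R β U μ (klFlowFrameU L₂ M₂ β U μ j) j) →
      (∀ m < n, ∀ θ : ℝ, |klLocalPart L₁ M₂ β U μ (klFlowFrameU L₁ M₂ β U μ m) m θ -
        klLocalPart L₂ M₂ β U μ (klFlowFrameU L₂ M₂ β U μ m) m θ| ≤ a m / L₁) →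
      (∀ q : Fin 2 → ℝ, |(klFlowFrameU L₁ M₂ β U μ n).eval q - (klFlowFrameU L₂ M₂ β U μ n).eval q| ≤ (∑ m ∈ range n, a m) / L₁) →
        ∀ θ : ℝ, |(symInterp L₁ (klLocSelfEnergyRe L₁ M₂ β U μ (klFlowFrameU L₁ M₂ β U μ n) n)).eval
              (klFermiPoint μ (klFlowFrameU L₂ M₂ β U μ n) θ) -
            (symInterp L₂ (klLocSelfEnergyRe L₂ M₂ β U μ (klFlowFrameU L₂ M₂ β U μ n) n)).eval
              (klFermiPoint μ (klFlowFrameU L₂ M₂ β U μ n) θ)| ≤ d n / L₁)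
    (hbudget : ∀ n ≤ N, b n * (∑ m ∈ range n, a m) / klCurveD + d n ≤ a n) :
    ∀ n ≤ N, ∀ (Mq : ℕ → ℕ) (L₁ L₂ M₂ : ℕ) [NeZero L₁] [NeZero L₂] [NeZero M₂], L ≤ L₁ → L₁ ∣ L₂ → Q.M0 β L₁ ≤ M₂ → Mq L₁ ≤ M₂ →
      Q.M0 β L₂ ≤ M₂ → Mq L₂ ≤ M₂ →
      (∀ j < n, histV17F2 L₁ M₂ G P Q R β U μ j ∧ TwoLegSlopes L₁ M₂ R β U μ (klFlowFrameU L₁ M₂ β U μ j) j) →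
      (∀ j < n, histV17F2 L₂ M₂ G P Q R β U μ j ∧ TwoLegSlopes L₂ M₂ R β U μ (klFlowFrameU L₂ M₂ β U μ j) j) →
        ∀ θ : ℝ, |klLocalPart L₁ M₂ β U μ (klFlowFrameU L₁ M₂ β U μ n) n θ -
          klLocalPart L₂ M₂ β U μ (klFlowFrameU L₂ M₂ β U μ n) n θ| ≤ Q.CL β n / 4 / L₁ := by
  intro n hn Mq L₁ L₂ M₂ _ _ _ hLL₁ hdvd hM₁ hMq₁ hM₂ hMq₂ hh₁ hh₂ θ
  have hL₁0 : (0 : ℝ) < L₁ := by exact_mod_cast Nat.pos_of_ne_zero (NeZero.ne L₁)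
  have h := spLeg_allScales_of_pointDefects_hist (a := a)
    (hist := fun L'' M'' _ _ j => histV17F2 L'' M'' G P Q R β U μ j ∧ TwoLegSlopes L'' M'' R β U μ (klFlowFrameU L'' M'' β U μ j) j)
    hR hc hcle hU hUle hβmin hβc hμ (fun L' M' _ _ j h => histV17F2_slopes_contDiff L' M' j h) hb
    (fun _ hn _ _ _ _ _ _ h => frameOK_klFlowFrameU_of_histV17F2 hR h0 (hn.trans hN) h) hgrad hD hbudget
    n hn Mq L₁ L₂ M₂ hLL₁ hdvd hM₁ hMq₁ hM₂ hMq₂ hh₁ hh₂ θ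
  exact h.trans (div_le_div_of_nonneg_right (ha n hn) hL₁0.le)

end V17F2

end Summit.HubbardSuperconductivity.HubbardSuperconductivity.Theorems.EngineV8

end
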